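import Summits.CriticalPhenomena.PercolationContinuityZ3.Theorems.PercNearOneGluingNoHeavyLowerTailSunflowerPrincipalPetal
import Summits.CriticalPhenomena.PercolationContinuityZ3.Theorems.PercNearOneGluingNoHeavyLowerTailSunflowerForcedReduction
import HarnessLib
import HarnessLib.Audit

/-!
# `NoHeavyLowerTail` (crux stmt-CriticalPhenomena-4575), abstract sunflower cubic: the partition lemma ★ (`0 ≤ ZH`) — indeed Lemma B
# (`Ntri ≤ 3·SB`) — for every sunflower with a CENTRED petal (all petal-`i` sets share a common nonempty set `c`)

Support file (seat `prim-l12-p2` gen 13; `--supports stmt-CriticalPhenomena-4575`).  Nothing is asserted about the crux; no `sorry`, no named facts.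
Memo: run/shared/lean/prim/prim-l12/prim-l12-p2/FINDING-g13-PRINCIPAL-PETAL.md (§6).  This file GENERALISES `…SunflowerPrincipalCube` /
`…SunflowerPrincipalPetal` (least-element petal = `c` is itself a petal set) to centred petals: `⋂ C_i ⊇ c ≠ ∅`.

THE NEW STEP.  In the polarised family of `…SunflowerPrincipalCube` the two "block" terms (`S = c`, `S = ∅`) now switch between the
Harris-type form `v(Q) − v(R)` and the Gladkov form `kk (lab Q) (lab R)` according to whether the `c`-side set `Q` lies in the up-closure `U`
of the petal (`Sunflower.rho`).  Exposing a coordinate, the two real terms and the two virtual terms have form bits `b⁰ ≤ b¹` (`U` is an up-set):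
`(1,1)` regroups linearly, `(0,0)` is `kk_submod`, and the MIXED case `(0,1)` is the pointwise monotonicity of `t ↦ kk s t + v23 t` along
comparable `t⁰ ≤ t¹` avoiding the label `1` (`kk_add_v23_mono`, decide) — the complement-side sets never contain `c`, hence are never petal-`0`
sets.  Base case and the identification with the cube inequality are as in the principal case.

RESULTS.  `Sunflower.thetaC_nonneg` (the family), `Sunflower.cube_le_centered` (on every cube the Gladkov surplus pays for the (petal-0, kernel)
antipodal pairs), `Sunflower.Ntri_le_three_SB_of_centered` (Lemma B), **`Sunflower.ZH_nonneg_of_centered_petal`** (★ for any centred petal `i`),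
**`ZH_ofUpsets_nonneg_of_centered`** ((R2) for three up-sets one of which is centred: all its members contain a fixed nonempty set — e.g. all
members contain a fixed point).  In the weight language of the memo: for every cube, every 2-petal structure and every CENTRED up-set `𝒮`,
`Σ_{Q ∈ 𝒮} w(Q) ≥ ½ Σ_Q w(Q)`; the general intersecting case (e.g. the triangle `↑{ab,ac,bc}`) remains conjectural (IX-gen).
-/

namespace Summit.CriticalPhenomena.PercolationContinuityZ3.Theorems.SunflowerPartition

open Finset

variable {α : Type*} [Fintype α] [DecidableEq α]

/-- Mixed-case kernel fact: `t ↦ kk s t + v23 t` is monotone along comparable labels avoiding the petal-`0` label `1`. [this work] -/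
theorem kk_add_v23_mono : ∀ s t0 t1 : Fin 5, t0 ≠ 1 → t1 ≠ 1 → (t0 = t1 ∨ t0 = 0 ∨ t1 = 4) →
    kk s t0 + v23 t0 ≤ kk s t1 + v23 t1 := by decide

namespace Sunflower

variable (F : Sunflower α)

/-- The form-switching block term: Harris-type if the `c`-side set lies in `U`, Gladkov kernel otherwise. [this work] -/
def rho (U : Finset (Finset α)) (Q R : Finset α) : ℤ := if Q ∈ U then F.vS Q - F.vS R else kk (F.lab Q) (F.lab R)

/-- The summand of the centred polarised family. [this work] -/
def psiC (U : Finset (Finset α)) (c E W S X : Finset α) : ℤ :=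
  if S = c then F.rho U (c ∪ E ∪ X) (E ∪ (W \ X))
  else if S = ∅ then F.rho U (c ∪ E ∪ (W \ X)) (E ∪ X)
  else kk (F.lab (S ∪ E ∪ X)) (F.lab ((c \ S) ∪ E ∪ (W \ X)))

omit [Fintype α] in
/-- A set not containing the (nonempty) centre is not a petal-`0` set. [this work] -/
theorem lab_ne_one_of_not_subset {c T : Finset α} (hc : ∀ T, F.lab T = 1 → c ⊆ T) (h : ¬ c ⊆ T) : F.lab T ≠ 1 :=
  fun h1 => h (hc T h1)

omit [Fintype α] in
/-- Sets of the form `E ∪ Z` with `E, Z` disjoint from a nonempty `c` do not contain `c`. [this work] -/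
theorem not_subset_union_of_disjoint {c E Z : Finset α} (hne : c.Nonempty) (hE : Disjoint c E) (hZ : Disjoint c Z) : ¬ c ⊆ E ∪ Z := by
  intro h
  obtain ⟨x, hx⟩ := hne
  rcases mem_union.1 (h hx) with h' | h'
  · exact Finset.disjoint_left.1 hE hx h'
  · exact Finset.disjoint_left.1 hZ hx h'

omit [Fintype α] in
/-- The three-case step inequality for the block term. [this work] -/
theorem rho_step {U : Finset (Finset α)} (hU : IsUpperSet (U : Set (Finset α))) {c : Finset α} (hc : ∀ T, F.lab T = 1 → c ⊆ T)
    {Q0 Q1 R0 R1 : Finset α} (hQ : Q0 ⊆ Q1) (hR : R0 ⊆ R1) (hR0 : ¬ c ⊆ R0) (hR1 : ¬ c ⊆ R1) :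
    F.rho U Q0 R0 + F.rho U Q1 R1 ≤ F.rho U Q0 R1 + F.rho U Q1 R0 := by
  have hmQ := F.lab_mono hQ
  have hmR := F.lab_mono hR
  have n0 := F.lab_ne_one_of_not_subset hc hR0
  have n1 := F.lab_ne_one_of_not_subset hc hR1
  unfold rho
  by_cases b0 : Q0 ∈ U
  · have b1 : Q1 ∈ U := hU hQ b0
    rw [if_pos b0, if_pos b1, if_pos b0, if_pos b1]
    linarith
  · rw [if_neg b0, if_neg b0]
    by_cases b1 : Q1 ∈ U
    · rw [if_pos b1, if_pos b1]
      have := kk_add_v23_mono (F.lab Q0) (F.lab R0) (F.lab R1) n0 n1 hmR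
      unfold vS
      linarith
    · rw [if_neg b1, if_neg b1]
      have := kk_submod _ _ _ _ hmQ hmR
      linarith

omit [Fintype α] in
/-- Base case: the block term dominates both extreme terms of the polarised Gladkov sum. [this work] -/
theorem kk_le_rho (U : Finset (Finset α)) (c E : Finset α) :
    kk (F.lab (E ∪ c)) (F.lab E) ≤ F.rho U (c ∪ E) E ∧ kk (F.lab E) (F.lab (E ∪ c)) ≤ F.rho U (c ∪ E) E := by
  unfold rho
  by_cases h : c ∪ E ∈ U
  · rw [if_pos h]
    exact F.kk_le_vS_sub c E
  · rw [if_neg h, union_comm c E, kk_comm (F.lab E)]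
    exact ⟨le_rfl, le_rfl⟩

/-- **`Θ_c(E;W) ≥ 0`** — the centred polarised family is nonnegative (induction on `W`). [this work] -/
theorem thetaC_nonneg {c : Finset α} (hne : c.Nonempty) (hc : ∀ T, F.lab T = 1 → c ⊆ T) (U : Finset (Finset α))
    (hU : IsUpperSet (U : Set (Finset α))) :
    ∀ (W E : Finset α), Disjoint c W → Disjoint c E → 0 ≤ ∑ S ∈ c.powerset, ∑ X ∈ W.powerset, F.psiC U c E W S X := by
  intro W
  induction W using Finset.induction_on with
  | empty =>
    intro E _ _
    simp only [powerset_empty, sum_singleton]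
    have hG := F.antipodal_sum_nonneg c E E subset_rfl
    refine le_trans hG (sum_le_sum fun S hS => ?_)
    unfold psiC
    by_cases h1 : S = c
    · subst h1
      simp only [if_true, sdiff_self, bot_eq_empty, union_empty]
      exact (F.kk_le_rho U S E).1
    · rw [if_neg h1]
      by_cases h2 : S = ∅
      · subst h2
        simp only [if_true, sdiff_empty, union_empty, empty_union]
        exact (F.kk_le_rho U c E).2
      · rw [if_neg h2]
        simp only [sdiff_empty, union_empty]
        rw [union_comm S E, union_comm (c \ S) E]
  | insert e W' he ih =>
    intro E hW hE
    have heW : Disjoint c W' := Disjoint.mono_right (subset_insert e W') hW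
    have hec : e ∉ c := fun h => Finset.disjoint_left.1 hW h (mem_insert_self e W')
    have heE : Disjoint c (insert e E) := by
      rw [Finset.disjoint_insert_right]; exact ⟨hec, hE⟩
    have hsplit : ∀ S ∈ c.powerset,
        ∑ X ∈ (insert e W').powerset, F.psiC U c E (insert e W') S X
          = ∑ X ∈ W'.powerset, (F.psiC U c E (insert e W') S X + F.psiC U c E (insert e W') S (insert e X)) := by
      intro S _
      rw [sum_powerset_insert he, sum_add_distrib]
    rw [sum_congr rfl hsplit]
    have key : ∀ S ∈ c.powerset, ∀ X ∈ W'.powerset,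
        F.psiC U c E W' S X + F.psiC U c (insert e E) W' S X
          ≤ F.psiC U c E (insert e W') S X + F.psiC U c E (insert e W') S (insert e X) := by
      intro S hS X hX
      have hXW : X ⊆ W' := mem_powerset.1 hX
      have heX : e ∉ X := fun hx => he (hXW hx)
      have e1 : insert e W' \ X = insert e (W' \ X) := insert_sdiff_of_notMem W' heX
      have e2 : insert e W' \ insert e X = W' \ X := insert_sdiff_insert_of_not_mem he
      have hdX : Disjoint c X := Disjoint.mono_right hXW heW
      have hdY : Disjoint c (W' \ X) := Disjoint.mono_right sdiff_subset heW
      unfold psiC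
      by_cases h1 : S = c
      · simp only [h1, if_true, e1, e2]
        rw [union_insert_eq e E (W' \ X), union_insert_eq e (c ∪ E) X, ← union_insert e c E]
        have h := F.rho_step hU hc (Q0 := c ∪ E ∪ X) (Q1 := c ∪ insert e E ∪ X) (R0 := E ∪ (W' \ X)) (R1 := insert e E ∪ (W' \ X))
          (union_subset_union (union_subset_union (subset_refl c) (subset_insert e E)) (subset_refl X))
          (union_subset_union (subset_insert e E) (subset_refl _))
          (not_subset_union_of_disjoint hne hE hdY) (not_subset_union_of_disjoint hne heE hdY)
        linarith
      · simp only [if_neg h1]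
        by_cases h2 : S = ∅
        · simp only [h2, if_true, e1, e2]
          rw [union_insert_eq e (c ∪ E) (W' \ X), ← union_insert e c E, union_insert_eq e E X]
          have h := F.rho_step hU hc (Q0 := c ∪ E ∪ (W' \ X)) (Q1 := c ∪ insert e E ∪ (W' \ X)) (R0 := E ∪ X) (R1 := insert e E ∪ X)
            (union_subset_union (union_subset_union (subset_refl c) (subset_insert e E)) (subset_refl _))
            (union_subset_union (subset_insert e E) (subset_refl _))
            (not_subset_union_of_disjoint hne hE hdX) (not_subset_union_of_disjoint hne heE hdX)
          linarith
        · simp only [if_neg h2, e1, e2]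
          rw [union_insert_eq e (c \ S ∪ E) (W' \ X), ← union_insert e (c \ S) E, union_insert_eq e (S ∪ E) X,
            ← union_insert e S E]
          have hm1 := F.lab_mono (union_subset_union (union_subset_union (subset_refl S) (subset_insert e E)) (subset_refl X))
          have hm2 := F.lab_mono (union_subset_union (union_subset_union (subset_refl (c \ S)) (subset_insert e E))
            (subset_refl (W' \ X)))
          have := kk_submod _ _ _ _ hm1 hm2
          linarith
    have hsum : ∑ S ∈ c.powerset, ∑ X ∈ W'.powerset, (F.psiC U c E W' S X + F.psiC U c (insert e E) W' S X)
        ≤ ∑ S ∈ c.powerset, ∑ X ∈ W'.powerset,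
            (F.psiC U c E (insert e W') S X + F.psiC U c E (insert e W') S (insert e X)) :=
      sum_le_sum fun S hS => sum_le_sum fun X hX => key S hS X hX
    have ih1 := ih E heW hE
    have ih2 := ih (insert e E) heW heE
    have hadd : ∑ S ∈ c.powerset, ∑ X ∈ W'.powerset, (F.psiC U c E W' S X + F.psiC U c (insert e E) W' S X)
        = (∑ S ∈ c.powerset, ∑ X ∈ W'.powerset, F.psiC U c E W' S X)
          + ∑ S ∈ c.powerset, ∑ X ∈ W'.powerset, F.psiC U c (insert e E) W' S X := by
      rw [← sum_add_distrib]
      exact sum_congr rfl fun S _ => sum_add_distrib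
    linarith

/-! ## The cube inequality for a centred petal -/

/-- **The cube inequality, centred version**: if every petal-`0` set contains the nonempty set `c`, then on every cube `W` the antipodal pairs
labelled `(1,⊤)` or `(⊤,1)` are at most `Σ_{T ⊆ W} kk (lab T) (lab (W ∖ T))`. [this work] -/
theorem cube_le_centered {c : Finset α} (hne : c.Nonempty) (hC : ∀ S ∈ F.V 0, S ∉ F.A → c ⊆ S) (W : Finset α) :
    ∑ T ∈ W.powerset, (ind14 (F.lab T) (F.lab (W \ T)) + ind14 (F.lab (W \ T)) (F.lab T))
      ≤ ∑ T ∈ W.powerset, kk (F.lab T) (F.lab (W \ T)) := by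
  -- `U` = up-closure of the petal; it is an up-set inside `V 0` containing the petal, all of whose members contain `c`
  set U : Finset (Finset α) := upcl (F.petal 0) with hUdef
  have hU : IsUpperSet (U : Set (Finset α)) := upcl_upper _
  have hc : ∀ T, F.lab T = 1 → c ⊆ T := fun T h1 => F.subset_of_lab_eq_one hC h1
  have hU1 : ∀ T, F.lab T = 1 → T ∈ U := by
    intro T h1
    have hV : T ∈ F.V 0 := (F.lab_V0_iff T).1 (Or.inl h1)
    have hA : T ∉ F.A := fun hA => by
      have := (F.lab_eq_four_iff T).2 hA
      rw [h1] at this; exact absurd this (by decide)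
    exact mem_upcl.2 ⟨T, by unfold petal; exact mem_sdiff.2 ⟨hV, hA⟩, subset_rfl⟩
  have hUV : ∀ T ∈ U, F.lab T = 1 ∨ F.lab T = 4 := by
    intro T hT
    obtain ⟨P, hP, hPT⟩ := mem_upcl.1 hT
    have hPV : P ∈ F.V 0 := (mem_sdiff.1 (by unfold petal at hP; exact hP)).1
    exact (F.lab_V0_iff T).2 (F.upper 0 hPT hPV)
  have hUc : ∀ T ∈ U, c ⊆ T := by
    intro T hT
    obtain ⟨P, hP, hPT⟩ := mem_upcl.1 hT
    have hP' := mem_sdiff.1 (by unfold petal at hP; exact hP)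
    exact (hC P hP'.1 hP'.2).trans hPT
  by_cases hcW : c ⊆ W
  swap
  · have h0 : ∀ T ∈ W.powerset, ind14 (F.lab T) (F.lab (W \ T)) + ind14 (F.lab (W \ T)) (F.lab T) = 0 := by
      intro T hT
      have hTW : T ⊆ W := mem_powerset.1 hT
      have h1 : F.lab T ≠ 1 := fun h => hcW ((hc T h).trans hTW)
      have h2 : F.lab (W \ T) ≠ 1 := fun h => hcW ((hc _ h).trans sdiff_subset)
      unfold ind14
      rw [if_neg (fun h => h1 h.1), if_neg (fun h => h2 h.1)]; rfl
    rw [sum_congr rfl h0, sum_const_zero]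
    exact F.antipodal_gladkov W
  · set W' := W \ c with hW'
    have hd : Disjoint c W' := disjoint_sdiff
    have hW : W = c ∪ W' := (union_sdiff_of_subset hcW).symm
    rw [hW, sum_powerset_union_of_disjoint hd, sum_powerset_union_of_disjoint hd]
    have hΘ := F.thetaC_nonneg hne hc U hU W' ∅ hd (disjoint_empty_right c)
    have key : ∀ S ∈ c.powerset, ∀ X ∈ W'.powerset,
        kk (F.lab (S ∪ X)) (F.lab ((c ∪ W') \ (S ∪ X)))
          - (ind14 (F.lab (S ∪ X)) (F.lab ((c ∪ W') \ (S ∪ X))) + ind14 (F.lab ((c ∪ W') \ (S ∪ X))) (F.lab (S ∪ X)))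
          = F.psiC U c ∅ W' S X := by
      intro S hS X hX
      have hSc : S ⊆ c := mem_powerset.1 hS
      have hXW : X ⊆ W' := mem_powerset.1 hX
      rw [union_sdiff_union_eq hd hSc hXW]
      have hXc : ¬ c ⊆ X := fun h => by
        obtain ⟨x, hx⟩ := hne
        exact Finset.disjoint_left.1 hd hx (hXW (h hx))
      have hYc : ¬ c ⊆ W' \ X := fun h => by
        obtain ⟨x, hx⟩ := hne
        exact Finset.disjoint_left.1 hd hx (sdiff_subset (h hx))
      unfold psiC rho
      by_cases h1 : S = c
      · subst h1
        simp only [if_true, sdiff_self, bot_eq_empty, empty_union, union_empty]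
        have hy : F.lab (W' \ X) ≠ 1 := fun h => hYc (hc _ h)
        have e2 : ind14 (F.lab (W' \ X)) (F.lab (S ∪ X)) = 0 := by
          unfold ind14; rw [if_neg (fun h => hy h.1)]
        by_cases hQ : S ∪ X ∈ U
        · rw [if_pos hQ]
          have e1 := kk_eq_v23 _ _ (hUV _ hQ) hy
          unfold vS
          rw [e1, e2]; ring
        · rw [if_neg hQ]
          have hx : F.lab (S ∪ X) ≠ 1 := fun h => hQ (hU1 _ h)
          have e1 : ind14 (F.lab (S ∪ X)) (F.lab (W' \ X)) = 0 := by
            unfold ind14; rw [if_neg (fun h => hx h.1)]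
          rw [e1, e2]; ring
      · rw [if_neg h1]
        by_cases h2 : S = ∅
        · subst h2
          simp only [if_true, sdiff_empty, empty_union, union_empty]
          have hy : F.lab X ≠ 1 := fun h => hXc (hc _ h)
          have e2 : ind14 (F.lab X) (F.lab (c ∪ (W' \ X))) = 0 := by
            unfold ind14; rw [if_neg (fun h => hy h.1)]
          by_cases hQ : c ∪ (W' \ X) ∈ U
          · rw [if_pos hQ]
            have e1 := kk_eq_v23 _ _ (hUV _ hQ) hy
            unfold vS
            rw [kk_comm, e1, e2]; ring
          · rw [if_neg hQ]
            have hx : F.lab (c ∪ (W' \ X)) ≠ 1 := fun h => hQ (hU1 _ h)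
            have e1 : ind14 (F.lab (c ∪ (W' \ X))) (F.lab X) = 0 := by
              unfold ind14; rw [if_neg (fun h => hx h.1)]
            rw [e1, e2, kk_comm]; ring
        · rw [if_neg h2]
          simp only [union_empty]
          have hx : F.lab (S ∪ X) ≠ 1 := fun h => by
            have hcS : c ⊆ S := by
              intro x hx
              have := hc _ h hx
              rcases mem_union.1 this with h' | h'
              · exact h'
              · exact absurd (hXW h') (Finset.disjoint_left.1 hd hx)
            exact h1 (subset_antisymm hSc hcS)
          have hy : F.lab (c \ S ∪ (W' \ X)) ≠ 1 := fun h => by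
            have hcS : c ⊆ c \ S := by
              intro x hx
              have := hc _ h hx
              rcases mem_union.1 this with h' | h'
              · exact h'
              · exact absurd (sdiff_subset h') (Finset.disjoint_left.1 hd hx)
            apply h2
            ext x
            simp only [Finset.notMem_empty, iff_false]
            intro hxS
            have := hcS (hSc hxS)
            rw [mem_sdiff] at this
            exact this.2 hxS
          have e1 : ind14 (F.lab (S ∪ X)) (F.lab (c \ S ∪ (W' \ X))) = 0 := by
            unfold ind14; rw [if_neg (fun h => hx h.1)]
          have e2 : ind14 (F.lab (c \ S ∪ (W' \ X))) (F.lab (S ∪ X)) = 0 := by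
            unfold ind14; rw [if_neg (fun h => hy h.1)]
          rw [e1, e2]; ring
    have hsum : ∑ S ∈ c.powerset, ∑ X ∈ W'.powerset,
        (kk (F.lab (S ∪ X)) (F.lab ((c ∪ W') \ (S ∪ X)))
          - (ind14 (F.lab (S ∪ X)) (F.lab ((c ∪ W') \ (S ∪ X))) + ind14 (F.lab ((c ∪ W') \ (S ∪ X))) (F.lab (S ∪ X))))
        = ∑ S ∈ c.powerset, ∑ X ∈ W'.powerset, F.psiC U c ∅ W' S X :=
      sum_congr rfl fun S hS => sum_congr rfl fun X hX => key S hS X hX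
    rw [← hsum] at hΘ
    simp only [sum_sub_distrib] at hΘ
    linarith

/-! ## Lemma B and the partition lemma for centred petals -/

/-- **`2·N140 ≤ SB`** for a centred petal `0`. [this work] -/
theorem two_N140_le_SB_of_centered {c : Finset α} (hne : c.Nonempty) (hC : ∀ S ∈ F.V 0, S ∉ F.A → c ⊆ S) : 2 * F.N140 ≤ F.SB := by
  have e014 : F.N140 = ∑ q ∈ parts α, (if F.lab q.1 = 0 then (1 : ℤ) else 0) * ind14 (F.lab q.2) (F.lab (q.1 ∪ q.2)ᶜ) := by
    rw [sum_parts_cyc (α := α) (fun a b c => (if F.lab a = 0 then (1 : ℤ) else 0) * ind14 (F.lab b) (F.lab c))]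
    unfold N140 ind14
    refine sum_congr rfl fun q _ => ?_
    split_ifs <;> simp_all
  have e041 : F.N140 = ∑ q ∈ parts α, (if F.lab q.1 = 0 then (1 : ℤ) else 0) * ind14 (F.lab (q.1 ∪ q.2)ᶜ) (F.lab q.2) := by
    rw [sum_parts_swap13 (α := α) (fun a b c => (if F.lab a = 0 then (1 : ℤ) else 0) * ind14 (F.lab c) (F.lab b))]
    unfold N140 ind14
    refine sum_congr rfl fun q _ => ?_
    split_ifs <;> simp_all
  have hsum : 2 * F.N140 = ∑ q ∈ parts α, (if F.lab q.1 = 0 then (1 : ℤ) else 0) *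
      (ind14 (F.lab q.2) (F.lab (q.1 ∪ q.2)ᶜ) + ind14 (F.lab (q.1 ∪ q.2)ᶜ) (F.lab q.2)) := by
    have hs : (∑ q ∈ parts α, (if F.lab q.1 = 0 then (1 : ℤ) else 0) *
        (ind14 (F.lab q.2) (F.lab (q.1 ∪ q.2)ᶜ) + ind14 (F.lab (q.1 ∪ q.2)ᶜ) (F.lab q.2)))
        = (∑ q ∈ parts α, (if F.lab q.1 = 0 then (1 : ℤ) else 0) * ind14 (F.lab q.2) (F.lab (q.1 ∪ q.2)ᶜ))
          + ∑ q ∈ parts α, (if F.lab q.1 = 0 then (1 : ℤ) else 0) * ind14 (F.lab (q.1 ∪ q.2)ᶜ) (F.lab q.2) := by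
      rw [← sum_add_distrib]
      exact sum_congr rfl fun q _ => by ring
    rw [hs, ← e014, ← e041]
    ring
  rw [hsum]
  unfold SB Sw
  rw [sum_parts_eq (f := fun S T => (if F.lab S = 0 then (1 : ℤ) else 0) * (ind14 (F.lab T) (F.lab (S ∪ T)ᶜ) + ind14 (F.lab (S ∪ T)ᶜ) (F.lab T))),
    sum_parts_eq (f := fun S T => (if F.lab S = 0 then (1 : ℤ) else 0) * kk (F.lab T) (F.lab (S ∪ T)ᶜ))]
  refine sum_le_sum fun S _ => ?_
  rw [← mul_sum, ← mul_sum]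
  by_cases hS : F.lab S = 0
  · rw [if_pos hS, one_mul, one_mul]
    have h := F.cube_le_centered hne hC Sᶜ
    have hl : ∑ T ∈ Sᶜ.powerset, (ind14 (F.lab T) (F.lab (S ∪ T)ᶜ) + ind14 (F.lab (S ∪ T)ᶜ) (F.lab T))
        = ∑ T ∈ Sᶜ.powerset, (ind14 (F.lab T) (F.lab (Sᶜ \ T)) + ind14 (F.lab (Sᶜ \ T)) (F.lab T)) :=
      sum_congr rfl fun T _ => by rw [compl_union, sdiff_eq_inter_compl]
    have hr : ∑ T ∈ Sᶜ.powerset, kk (F.lab T) (F.lab (S ∪ T)ᶜ) = ∑ T ∈ Sᶜ.powerset, kk (F.lab T) (F.lab (Sᶜ \ T)) :=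
      sum_congr rfl fun T _ => by rw [compl_union, sdiff_eq_inter_compl]
    rw [hl, hr]
    exact h
  · rw [if_neg hS, zero_mul, zero_mul]

/-- **LEMMA B for a centred petal `0`**: if all petal-`0` sets contain a common nonempty set `c`, then `Ntri ≤ 3·SB`. [this work] -/
theorem Ntri_le_three_SB_of_centered {c : Finset α} (hne : c.Nonempty) (hC : ∀ S ∈ F.V 0, S ∉ F.A → c ⊆ S) : F.Ntri ≤ 3 * F.SB := by
  have h1 := F.N123_le_N140
  have h2 := F.two_N140_le_SB_of_centered hne hC
  have h3 := F.Ntri_eq_six_mul_N123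
  linarith

/-- **★ for a centred petal `0`**: `0 ≤ ZH`. [this work] -/
theorem ZH_nonneg_of_centered {c : Finset α} (hne : c.Nonempty) (hC : ∀ S ∈ F.V 0, S ∉ F.A → c ⊆ S) : 0 ≤ F.ZH := by
  rw [F.ZH_eq_SA_SB]
  have h1 := F.Ntri_le_three_SB_of_centered hne hC
  have h2 := F.SA_nonneg
  linarith

/-- **THE PARTITION LEMMA ★ FOR EVERY SUNFLOWER WITH A CENTRED PETAL**: if for some petal `i` all petal-`i` sets contain a common nonempty
set `c` (e.g. a common point), then `0 ≤ ZH`. [this work] -/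
theorem ZH_nonneg_of_centered_petal (i : Fin 3) {c : Finset α} (hne : c.Nonempty) (hC : ∀ S ∈ F.V i, S ∉ F.A → c ⊆ S) : 0 ≤ F.ZH := by
  fin_cases i
  · exact F.ZH_nonneg_of_centered hne hC
  · rw [← F.rotate_ZH]
    refine F.rotate.ZH_nonneg_of_centered (c := c) hne ?_
    intro S hS hSA
    rw [F.rotate_V.1] at hS
    rw [rotate_A] at hSA
    exact hC S hS hSA
  · rw [← F.rotate_ZH, ← F.rotate.rotate_ZH]
    refine F.rotate.rotate.ZH_nonneg_of_centered (c := c) hne ?_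
    intro S hS hSA
    rw [F.rotate.rotate_V.1, F.rotate_V.2.1] at hS
    rw [rotate_A, rotate_A] at hSA
    exact hC S hS hSA

end Sunflower

/-- **(R2) for three up-sets one of which is CENTRED** (all members of `U i` contain a fixed nonempty set `c`; e.g. `U i ⊆ ↑{x}`), the other two
arbitrary: the partition functional of the θ-pullback sunflower is `≥ 0`. [this work] -/
theorem ZH_ofUpsets_nonneg_of_centered (U : Fin 3 → Finset (Finset α)) (hU : ∀ i, IsUpperSet (U i : Set (Finset α))) (i : Fin 3)
    (c : Finset α) (hne : c.Nonempty) (hUi : ∀ S ∈ U i, c ⊆ S) : 0 ≤ (ofUpsets U hU).ZH :=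
  (ofUpsets U hU).ZH_nonneg_of_centered_petal i hne fun S hS hSA => hUi S (mem_U_of_mem_ofUpsets_V hU hS hSA)

end Summit.CriticalPhenomena.PercolationContinuityZ3.Theorems.SunflowerPartition
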